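import Summits.BirchSwinnertonDyer.Rank1Residual.Supersingular.KuriharaTwistRecordAssemblyBall
import Summits.BirchSwinnertonDyer.Rank1Residual.Supersingular.KuriharaTwistSymbolKuriharaOdd
import HarnessLib

/-!
# Twist records + rounding certificates, CLASS-FREE: `kuriharaNumber f p n ψ ≠ 0` from a `consistent` /
# `consistentOdd` record, its `validHasse` certificate and the engine's enclosure claim — for every
# consumer of the cell's Kurihara chains (X6/X7 at `p ≥ 5`; X6/X7/X8 and the additive classes at `p = 3`)

Cell `b2b-bsdres`, supersingular family, prover A = unit `b2b-bsdres-x10b` (gen 11).  Topic file; namespace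
`Summit.BirchSwinnertonDyer.Rank1Residual.Supersingular.KuriharaTwist`.  THEOREMS ONLY (compositions by
name); no named fact, no definition, nothing asserted about any curve, nothing booked; marks unchanged.

HONEST FRAMING (run/shared/lean/b2b/bsd-rank1-residual/, verbatim): the goal of the cell is to DELETE the
COMBINATION-SHAPED residual classes of the BSD formula in analytic rank `≤ 1` from PUBLISHED theorems only
and to TYPE the construction-shaped ones; this is not "finishing BSD".

## What this file adds to `KuriharaTwistRecordAssemblyBall.lean` (p289964)

That file replaced the exact-bins hypothesis `hbins` of the X6/X7 `p ≥ 5` assembled consumers by a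
rounding certificate + the enclosure claim `hball`.  Here the same replacement is made ONE LEVEL LOWER,
class-free, at the conclusion `kuriharaNumber f (p^1) n ψ ≠ 0` — the hypothesis `hδ` that EVERY Kurihara
consumer in the tree takes (`X6/X7.bsdp_of_kim_rank{Zero,One}_…` at `p ≥ 5`; at `p = 3` the CONDITIONAL
`X8RankZero/RankOne…kim2025_OPEN…`, `X7.bsdp_three_of_kim2025_OPEN_…`, `GoodThree…`, the additive
`X4.KuriharaUnitAt` shapes):
* `coprime_level_of_isKolyvaginProduct` — `gcd(n, N_f) = 1` from `n ∈ 𝒩₁(E, p)` and `IsNewformOf W f`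
  (Kolyvagin primes are good; the newform level is the conductor), so the `hcop` binder of p289964's
  consumers is DISCHARGED here rather than carried;
* `TwistRecord.kuriharaNumber_ne_zero_of_consistent_of_roundingCert` (`p ≥ 5` records, `CertifiedL`) and
  `TwistRecord.kuriharaNumber_ne_zero_of_consistentOdd_of_roundingCert` (odd `p`, `ν < p`, `CertifiedOddL`:
  the `p = 3` records of additive-p3's X8 files, n1011's X4 files and this seat's KP3 second-engine files)
  = gen 10's `…_of_isNewformOf` theorems with `hbins` replaced by: a `validHasse` certificate `c` matching
  `r` (`p, n, den, bins`; `0 < D'`), good reduction at `p`, and `hball`.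
Per pair; NOT a class theorem; nothing booked.  References: p289964, p274695, p272956 (this lineage);
[Kim2022StructureSelmer] Thm. 1.8 (6); [CremonaAlgorithms1997] §2.8.
-/

noncomputable section

open scoped Classical MatrixGroups ModularForm

open CongruenceSubgroup WeierstrassCurve Literature.NumberTheory.EllipticCurves
  Literature.NumberTheory.EllipticCurves.ModularForms

namespace Summit.BirchSwinnertonDyer.Rank1Residual.Supersingular.KuriharaTwist

variable {N : ℕ} [NeZero N] {f : CuspForm (Gamma0 N) 2}
  {W : WeierstrassCurve ℚ} [W.IsElliptic] [W.IsGloballyMinimal]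

/-- **`gcd(n, N_f) = 1` for a Kolyvagin level.** If `f` is the newform of `E = W` and `n ∈ 𝒩₁(E, p)`
(square-free product of Kolyvagin primes, each prime to the conductor), then `n` is prime to the level
`N` of `f`: a Kolyvagin prime is a prime of good reduction (`not_dvd_conductorNorm`), and a good prime does
not divide the newform level (`not_dvd_level_of_isNewformOf`). [folklore] -/
theorem coprime_level_of_isKolyvaginProduct (hf : IsNewformOf W f) {p : ℕ} [Fact p.Prime] {n : ℕ}
    [NeZero n] (hn : Kato.IsKolyvaginProduct W p 1 n) : Nat.Coprime n N :=
  Nat.coprime_of_dvd fun ℓ hℓp hℓn hℓN => by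
    haveI : Fact ℓ.Prime := ⟨hℓp⟩
    exact not_dvd_level_of_isNewformOf hf
      (hasGoodReductionAtPrime_of_not_dvd_conductorNorm W (hn.isKolyvaginPrime hℓp hℓn).not_dvd_conductorNorm)
      hℓN

/-- **`kuriharaNumber ≠ 0` FROM A `consistent` TWIST RECORD + ITS ROUNDING CERTIFICATE** (`p ≥ 5` records,
`CertifiedL`): gen 10's `TwistRecord.kuriharaNumber_ne_zero_of_consistent_of_isNewformOf` with the exact-bins
hypothesis `hbins` REPLACED by a `validHasse` certificate `c` matching `r` (`c.p = r.p`, `c.n = r.n`,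
`c.den = r.den`, `c.bins = r.bins`, `0 < c.dstar`), good reduction at `r.p`, and the engine's ENCLOSURE claim
`hball` (the Arb ball of recorded margin/radius contains `D'·c_∞·Σ_{m(a)=j}[a/n]⁺_f` for every `j < p`);
`gcd(n, N_f) = 1` is discharged by `coprime_level_of_isKolyvaginProduct`.  Class-free: this is the `hδ` of
every `p ≥ 5` Kurihara consumer. [cite: Kim2022StructureSelmer, Thm. 1.9 (6) (PDF p. 8)]
[cite: CremonaAlgorithms1997, §2.8 (2.8.8) (PDF p. 26)] -/
theorem TwistRecord.kuriharaNumber_ne_zero_of_consistent_of_roundingCert (r : TwistRecord)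
    (hc : r.consistent = true) (hδ : 0 < r.deltaModP) [Fact r.p.Prime] (hνp : r.primes.length < r.p)
    [NeZero r.n] (hν : r.n.primeFactors.card = r.primes.length)
    (hf : IsNewformOf W f) (hp2 : r.p ≠ 2) (hirr : W.HasIrreducibleModPGaloisRep r.p)
    (hgood : W.HasGoodReductionAtPrime r.p) (hn : Kato.IsKolyvaginProduct W r.p 1 r.n)
    {c : RoundingCert} (hcv : c.validHasse = true)
    (hcp : c.p = r.p) (hcn : c.n = r.n) (hcden : c.den = r.den) (hcbins : c.bins = r.bins) (hD' : 0 < c.dstar)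
    (ψ : (ℓ : ℕ) → (ZMod ℓ)ˣ →* Multiplicative (ZMod (r.p ^ 1)))
    (hball : ∀ j < r.p, ∃ mid rad : ℝ, rad ≤ (c.radNum : ℝ) / 10 ^ c.radExp ∧
      |mid - ((c.binsStar.getD j 0 : ℤ) : ℝ)| ≤ (c.marNum : ℝ) / 10 ^ c.marExp ∧
      |(c.dstar : ℝ) * (((r.components : ℚ) *
        ∑ a ∈ (Finset.univ : Finset (ZMod r.n)ˣ).filter (fun a =>
          (∑ ℓ ∈ r.n.primeFactors.attach, Multiplicative.toAdd
            (ψ ℓ.1 (ZMod.unitsMap (Nat.dvd_of_mem_primeFactors ℓ.2) a))).val = j),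
          ratPlusSymbol f ((((a : ZMod r.n).val : ℕ) : ℚ) / (r.n : ℚ)) : ℚ) : ℝ) - mid| ≤ rad) :
    kuriharaNumber f (r.p ^ 1) r.n ψ ≠ 0 :=
  r.kuriharaNumber_ne_zero_of_consistent_of_isNewformOf hc hδ hνp hν hf hp2 hirr hn ψ
    (r.bins_eq_of_validHasse_of_ball hcv hcp hcn hcden hcbins hD' hf hgood
      (coprime_level_of_isKolyvaginProduct hf hn) ψ hball)

/-- **`kuriharaNumber ≠ 0` FROM A `consistentOdd` TWIST RECORD + ITS ROUNDING CERTIFICATE** (odd `p`,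
`ν < p` inside the predicate — the `p = 3` records, `CertifiedOddL`): gen 10's
`TwistRecord.kuriharaNumber_ne_zero_of_consistentOdd_of_isNewformOf` with `hbins` REPLACED by a `validHasse`
certificate matching `r`, good reduction at `r.p`, and the enclosure claim `hball`.  Class-free: this is the
`kuriharaNumber … ≠ 0` hypothesis of the CONDITIONAL `p = 3` consumers (`X8RankZero/RankOne…kim2025_OPEN…`,
`X7.bsdp_three_of_kim2025_OPEN_…`, the X4 `KuriharaUnitAt` shapes) — the records stay certificate VALUES under
the Kim 2025 OPEN binder; nothing booked. [cite: Kim2022StructureSelmer, §1.4.3 (PDF p. 7)]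
[cite: CremonaAlgorithms1997, §2.8 (2.8.8) (PDF p. 26)] -/
theorem TwistRecord.kuriharaNumber_ne_zero_of_consistentOdd_of_roundingCert (r : TwistRecord)
    (hc : r.consistentOdd = true) (hδ : 0 < r.deltaModP) [Fact r.p.Prime] [NeZero r.n]
    (hν : r.n.primeFactors.card = r.primes.length)
    (hf : IsNewformOf W f) (hp2 : r.p ≠ 2) (hirr : W.HasIrreducibleModPGaloisRep r.p)
    (hgood : W.HasGoodReductionAtPrime r.p) (hn : Kato.IsKolyvaginProduct W r.p 1 r.n)
    {c : RoundingCert} (hcv : c.validHasse = true)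
    (hcp : c.p = r.p) (hcn : c.n = r.n) (hcden : c.den = r.den) (hcbins : c.bins = r.bins) (hD' : 0 < c.dstar)
    (ψ : (ℓ : ℕ) → (ZMod ℓ)ˣ →* Multiplicative (ZMod (r.p ^ 1)))
    (hball : ∀ j < r.p, ∃ mid rad : ℝ, rad ≤ (c.radNum : ℝ) / 10 ^ c.radExp ∧
      |mid - ((c.binsStar.getD j 0 : ℤ) : ℝ)| ≤ (c.marNum : ℝ) / 10 ^ c.marExp ∧
      |(c.dstar : ℝ) * (((r.components : ℚ) *
        ∑ a ∈ (Finset.univ : Finset (ZMod r.n)ˣ).filter (fun a =>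
          (∑ ℓ ∈ r.n.primeFactors.attach, Multiplicative.toAdd
            (ψ ℓ.1 (ZMod.unitsMap (Nat.dvd_of_mem_primeFactors ℓ.2) a))).val = j),
          ratPlusSymbol f ((((a : ZMod r.n).val : ℕ) : ℚ) / (r.n : ℚ)) : ℚ) : ℝ) - mid| ≤ rad) :
    kuriharaNumber f (r.p ^ 1) r.n ψ ≠ 0 :=
  r.kuriharaNumber_ne_zero_of_consistentOdd_of_isNewformOf hc hδ hν hf hp2 hirr hn ψ
    (r.bins_eq_of_validHasse_of_ball hcv hcp hcn hcden hcbins hD' hf hgood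
      (coprime_level_of_isKolyvaginProduct hf hn) ψ hball)

/-- **Record-list form, `CertifiedL` + `RoundingCertifiedHasse`** (`p ≥ 5`): rows `r ∈ rs`, `c ∈ cs` of two
LANDED `decide`d lists, matching, + binders + `hball` ⟹ `kuriharaNumber ≠ 0`.
[cite: Kim2022StructureSelmer, Thm. 1.9 (6) (PDF p. 8)] -/
theorem CertifiedL.kuriharaNumber_ne_zero_of_roundingCert {rs : List TwistRecord} (hrs : CertifiedL rs)
    {r : TwistRecord} (hr : r ∈ rs) [Fact r.p.Prime] (hνp : r.primes.length < r.p)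
    [NeZero r.n] (hν : r.n.primeFactors.card = r.primes.length)
    (hf : IsNewformOf W f) (hp2 : r.p ≠ 2) (hirr : W.HasIrreducibleModPGaloisRep r.p)
    (hgood : W.HasGoodReductionAtPrime r.p) (hn : Kato.IsKolyvaginProduct W r.p 1 r.n)
    {cs : List RoundingCert} (hcs : RoundingCertifiedHasse cs) {c : RoundingCert} (hc : c ∈ cs)
    (hcp : c.p = r.p) (hcn : c.n = r.n) (hcden : c.den = r.den) (hcbins : c.bins = r.bins) (hD' : 0 < c.dstar)
    (ψ : (ℓ : ℕ) → (ZMod ℓ)ˣ →* Multiplicative (ZMod (r.p ^ 1)))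
    (hball : ∀ j < r.p, ∃ mid rad : ℝ, rad ≤ (c.radNum : ℝ) / 10 ^ c.radExp ∧
      |mid - ((c.binsStar.getD j 0 : ℤ) : ℝ)| ≤ (c.marNum : ℝ) / 10 ^ c.marExp ∧
      |(c.dstar : ℝ) * (((r.components : ℚ) *
        ∑ a ∈ (Finset.univ : Finset (ZMod r.n)ˣ).filter (fun a =>
          (∑ ℓ ∈ r.n.primeFactors.attach, Multiplicative.toAdd
            (ψ ℓ.1 (ZMod.unitsMap (Nat.dvd_of_mem_primeFactors ℓ.2) a))).val = j),
          ratPlusSymbol f ((((a : ZMod r.n).val : ℕ) : ℚ) / (r.n : ℚ)) : ℚ) : ℝ) - mid| ≤ rad) :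
    kuriharaNumber f (r.p ^ 1) r.n ψ ≠ 0 :=
  r.kuriharaNumber_ne_zero_of_consistent_of_roundingCert (hrs.consistent_of_mem hr)
    (hrs.deltaModP_pos_of_mem hr) hνp hν hf hp2 hirr hgood hn (hcs.validHasse_of_mem hc) hcp hcn hcden
    hcbins hD' ψ hball

/-- **Record-list form, `CertifiedOddL` + `RoundingCertifiedHasse`** (`p = 3` records): rows `r ∈ rs`,
`c ∈ cs` of two LANDED `decide`d lists, matching, + binders + `hball` ⟹ `kuriharaNumber ≠ 0` — the input of the
CONDITIONAL `p = 3` consumers; nothing booked. [cite: Kim2022StructureSelmer, §1.4.3 (PDF p. 7)] -/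
theorem CertifiedOddL.kuriharaNumber_ne_zero_of_roundingCert {rs : List TwistRecord} (hrs : CertifiedOddL rs)
    {r : TwistRecord} (hr : r ∈ rs) [Fact r.p.Prime] [NeZero r.n]
    (hν : r.n.primeFactors.card = r.primes.length)
    (hf : IsNewformOf W f) (hp2 : r.p ≠ 2) (hirr : W.HasIrreducibleModPGaloisRep r.p)
    (hgood : W.HasGoodReductionAtPrime r.p) (hn : Kato.IsKolyvaginProduct W r.p 1 r.n)
    {cs : List RoundingCert} (hcs : RoundingCertifiedHasse cs) {c : RoundingCert} (hc : c ∈ cs)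
    (hcp : c.p = r.p) (hcn : c.n = r.n) (hcden : c.den = r.den) (hcbins : c.bins = r.bins) (hD' : 0 < c.dstar)
    (ψ : (ℓ : ℕ) → (ZMod ℓ)ˣ →* Multiplicative (ZMod (r.p ^ 1)))
    (hball : ∀ j < r.p, ∃ mid rad : ℝ, rad ≤ (c.radNum : ℝ) / 10 ^ c.radExp ∧
      |mid - ((c.binsStar.getD j 0 : ℤ) : ℝ)| ≤ (c.marNum : ℝ) / 10 ^ c.marExp ∧
      |(c.dstar : ℝ) * (((r.components : ℚ) *
        ∑ a ∈ (Finset.univ : Finset (ZMod r.n)ˣ).filter (fun a =>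
          (∑ ℓ ∈ r.n.primeFactors.attach, Multiplicative.toAdd
            (ψ ℓ.1 (ZMod.unitsMap (Nat.dvd_of_mem_primeFactors ℓ.2) a))).val = j),
          ratPlusSymbol f ((((a : ZMod r.n).val : ℕ) : ℚ) / (r.n : ℚ)) : ℚ) : ℝ) - mid| ≤ rad) :
    kuriharaNumber f (r.p ^ 1) r.n ψ ≠ 0 := by
  have hnv : r.nonvanishingOdd = true := hrs.nonvanishingOdd_of_mem hr
  have hc' : r.consistentOdd = true ∧ 0 < r.deltaModP := by
    simpa [TwistRecord.nonvanishingOdd, Bool.and_eq_true, decide_eq_true_eq] using hnv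
  exact r.kuriharaNumber_ne_zero_of_consistentOdd_of_roundingCert hc'.1 hc'.2 hν hf hp2 hirr hgood hn
    (hcs.validHasse_of_mem hc) hcp hcn hcden hcbins hD' ψ hball

end Summit.BirchSwinnertonDyer.Rank1Residual.Supersingular.KuriharaTwist

end
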